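import Summits.QuantumAdvantage.AdviceFreeQNC0.WalkCharacters
import HarnessLib

/-!
# Cell qa-qnc0 (rung F-Q1, route RingFrame, crux α `RingToElim`): the FULL EXACT LAW — no perfect
# strategy of degree `D` on `2D+3` bits (planner qa-qnc0-p1 TARGET §15.2, all `D`)

Planner qa-qnc0-p1's "FULL EXACT LAW" (TARGET §15.2, typed there as `FullExactLaw` and asked of a
prover in §15.7), made kernel for every `D`; the tree held only the dual certificates
`noExactResolvent_5_1 … _12_4` (`ExactResolventCertificates*.lean`, `n ≤ 12`).  Over the toolkit
of `WalkCharacters.lean`: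

* `Lfun`, `Lfun_chi`, `Lfun_eq_zero_of_mem`, `Lfun_one_ne_zero` — the coefficient functional
  `L_a(f) = Σ_u f(u)·Πᵢ ω^{−aᵢ(1−uᵢ)}`: `L_a(χ_b) = δ_{ab}`, so `L_a` kills every span of
  characters avoiding `a`, while `L_a(1)` is a unit;
* `pdist_alt_aPat`, `pdist_conj_alt_aPat` — on `m = 2D+3` letters the alternating pattern
  `(1,2,1,2,…)` and its conjugate are at Hamming distance `≥ D+1` from EVERY path pattern
  `2^g 1^{m−g}` (explicit injections `Fin (D+1) ↪ mismatches`);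
* `fullSpan m D` — the module `M_D(P) = Σ_g 𝔽₄[u]_{≤D}·χ_{a^{(g)}}` of FULL strategies (free
  `𝔽₄[u]_{≤D}` coefficient at every cut: stakes on all three residues), `fullSpan_le_chiSpan`
  (its spectrum is within distance `D` of the path);
* **`fullSpan_not_perfect`** — THE LAW: for `f ∈ M_D(P)` on `2D+3` bits, `tr f ≢ 1`.  Proof:
  `tr f = f + f²` has spectrum in `N_D(P) ∪ N_D(P̄)`; the alternating pattern is outside; apply
  `L_alt` to `tr f = 1`.

Every walk / ring strategy of `𝔽₂`-degree `D` (and every restriction of one to a block of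
`2D+3` consecutive bits) is such an `f`, so none is perfect; `WalkFailFloor.lean` turns this into the
floor `#FAIL ≥ 2^{ℓ−2D−3}` for all `ℓ ≥ 2D+3` — rung 0 of planner qa-qnc0-p1's DENSITY AXIS
(ROUND-11 §1.1, exponent `2`; T10 asks for exponent `< 1`).  The cell's theorem (planner
qa-qnc0-p1 gen 3, statement and proof sketch; prover qn-prover-3 gen 5, kernel proof), 2026-08-27;
not in print.  WHAT THIS IS NOT: the converse (perfect play at `D ≥ ⌊(ℓ−1)/2⌋`) and the ring
phase law (§15.3) are not formalised; no constant-loss statement; no separation claim.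
-/

noncomputable section

namespace Summit.QuantumAdvantage.AdviceFreeQNC0

open Finset
open Literature.Computability.MetaComplexity Literature.Computability.MetaComplexity.Smolensky
open F4

variable {m : ℕ}

/-! ### The coefficient functional -/

/-- `L_a(f) = Σ_u f(u) · Πᵢ ω^{−aᵢ(1−uᵢ)}` (`ω^{−aᵢ} = ω^{letter of ¬aᵢ}`). -/
def Lfun (a : Fin m → Bool) (f : (Fin m → Bool) → F4) : F4 :=
  ∑ u, f u * ∏ i, (if u i then 1 else ω ^ lett (!a i))

/-- `L_a` kills every character but `χ_a`: `L_a(χ_b) = [a = b]`. -/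
theorem Lfun_chi (a b : Fin m → Bool) : Lfun a (chi b) = if a = b then 1 else 0 := by
  classical
  unfold Lfun chi
  have e : ∀ u : Fin m → Bool,
      (∏ i, (if u i = true then ω ^ lett (b i) else 1)) * ∏ i, (if u i = true then 1 else ω ^ lett (!a i)) =
        ∏ i, (if u i = true then ω ^ lett (b i) else ω ^ lett (!a i)) := by
    intro u
    rw [← Finset.prod_mul_distrib]
    refine Finset.prod_congr rfl fun i _ => ?_
    by_cases hu : u i = true <;> simp [hu]
  rw [Finset.sum_congr rfl fun u _ => e u]
  have h := Finset.prod_univ_sum (fun _ : Fin m => (univ : Finset Bool))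
    (fun i bb => if bb = true then ω ^ lett (b i) else ω ^ lett (!a i))
  rw [Fintype.piFinset_univ] at h
  rw [← h]
  have hfac : ∀ i, (∑ bb : Bool, if bb = true then ω ^ lett (b i) else ω ^ lett (!a i)) =
      if a i = b i then 1 else 0 := by
    intro i
    rw [Fintype.sum_bool]
    simp only [if_true, Bool.false_eq_true, if_false]
    unfold lett
    cases a i <;> cases b i <;> simp [omega_add_omega_sq, add_self, add_comm]
  simp_rw [hfac]
  by_cases hab : a = b
  · rw [if_pos hab, hab]
    simp
  · rw [if_neg hab]
    obtain ⟨i, hi⟩ : ∃ i, a i ≠ b i := Function.ne_iff.mp hab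
    exact Finset.prod_eq_zero (Finset.mem_univ i) (if_neg hi)

/-- `L_a` vanishes on the span of characters `χ_b` with `¬ P a`. -/
theorem Lfun_eq_zero_of_mem {P : (Fin m → Bool) → Prop} {a : Fin m → Bool} (ha : ¬ P a)
    {f : (Fin m → Bool) → F4} (hf : f ∈ chiSpan P) : Lfun a f = 0 := by
  unfold chiSpan at hf
  induction hf using Submodule.span_induction with
  | mem g hg =>
    obtain ⟨b, hb, rfl⟩ := hg
    rw [Lfun_chi, if_neg]
    rintro rfl
    exact ha hb
  | zero => simp [Lfun]
  | add g h _ _ hg hh =>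
    have e : Lfun a (g + h) = Lfun a g + Lfun a h := by
      unfold Lfun; rw [← Finset.sum_add_distrib]
      exact Finset.sum_congr rfl fun u _ => by rw [Pi.add_apply, add_mul]
    rw [e, hg, hh, add_zero]
  | smul c g _ hg =>
    have e : Lfun a (c • g) = c * Lfun a g := by
      unfold Lfun; rw [Finset.mul_sum]
      exact Finset.sum_congr rfl fun u _ => by rw [Pi.smul_apply, smul_eq_mul, mul_assoc]
    rw [e, hg, mul_zero]

/-- `L_a(1)` is a unit (a power of `ω`), hence nonzero. -/
theorem Lfun_one_ne_zero (a : Fin m → Bool) : Lfun a (fun _ => 1) ≠ 0 := by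
  classical
  haveI := F4.nontrivial
  unfold Lfun
  simp only [one_mul]
  have h := Finset.prod_univ_sum (fun _ : Fin m => (univ : Finset Bool))
    (fun i bb => if bb = true then (1 : F4) else ω ^ lett (!a i))
  rw [Fintype.piFinset_univ] at h
  rw [← h]
  have hunit : IsUnit (∏ i : Fin m, ∑ bb : Bool, if bb = true then (1 : F4) else ω ^ lett (!a i)) := by
    refine IsUnit.prod_univ_iff.2 fun i => ?_
    rw [Fintype.sum_bool]
    simp only [if_true, Bool.false_eq_true, if_false]
    unfold lett
    cases a i
    · simp only [Bool.not_false, if_true]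
      rw [one_add_omega_sq, ← pow_one ω]; exact isUnit_omega_pow 1
    · simp only [Bool.not_true, Bool.false_eq_true, if_false, pow_one]
      rw [one_add_omega]; exact isUnit_omega_pow 2
  exact hunit.ne_zero

/-! ### The far pattern -/

/-- The alternating pattern `(1,2,1,2,…)`: letter `2` at the odd positions. -/
def alt : Fin m → Bool := fun i => decide (i.val % 2 = 1)

/-- Where `alt` differs from the path pattern `a^{(g)}`. -/
theorem alt_ne_aPat_iff (g : ℕ) (i : Fin m) :
    alt i ≠ aPat g i ↔ (i.val % 2 = 0 ∧ i.val < g) ∨ (i.val % 2 = 1 ∧ g ≤ i.val) := by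
  unfold alt aPat
  rw [ne_eq, decide_eq_decide]
  omega

/-- Where the conjugate of `alt` differs from the path pattern `a^{(g)}`. -/
theorem conj_alt_ne_aPat_iff (g : ℕ) (i : Fin m) :
    conj alt i ≠ aPat g i ↔ (i.val % 2 = 1 ∧ i.val < g) ∨ (i.val % 2 = 0 ∧ g ≤ i.val) := by
  unfold conj alt aPat
  rw [← decide_not, ne_eq, decide_eq_decide]
  omega

/-- On `m = 2D+3` letters, `alt` is at distance `≥ D+1` from every path pattern. -/
theorem pdist_alt_aPat (D g : ℕ) : D + 1 ≤ pdist (alt : Fin (2 * D + 3) → Bool) (aPat g) := by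
  classical
  unfold pdist
  -- inject `Fin (D+1)`: `j ↦ 2j` if `2j+1 < g` (an even position before `g`), else `2j+1`
  let φ : Fin (D + 1) → Fin (2 * D + 3) := fun j =>
    if 2 * j.val + 1 < g then ⟨2 * j.val, by omega⟩ else ⟨2 * j.val + 1, by omega⟩
  have hφv : ∀ j : Fin (D + 1), (φ j).val = if 2 * j.val + 1 < g then 2 * j.val else 2 * j.val + 1 := by
    intro j
    show (if 2 * j.val + 1 < g then (⟨2 * j.val, _⟩ : Fin (2 * D + 3)) else ⟨2 * j.val + 1, _⟩).val = _
    split_ifs <;> rfl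
  have hinj : Function.Injective φ := by
    intro j j' h
    have hv : (φ j).val = (φ j').val := by rw [h]
    rw [hφv, hφv] at hv
    apply Fin.ext
    split_ifs at hv <;> omega
  have hcard : (univ.image φ).card = D + 1 := by
    rw [Finset.card_image_of_injective _ hinj]; simp
  rw [← hcard]
  refine Finset.card_le_card fun i hi => ?_
  rw [Finset.mem_image] at hi
  obtain ⟨j, -, rfl⟩ := hi
  rw [Finset.mem_filter, alt_ne_aPat_iff, hφv]
  refine ⟨Finset.mem_univ _, ?_⟩
  split_ifs with h1 <;> omega

/-- On `m = 2D+3` letters, the conjugate of `alt` is at distance `≥ D+1` from every path pattern. -/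
theorem pdist_conj_alt_aPat (D g : ℕ) :
    D + 1 ≤ pdist (conj (alt : Fin (2 * D + 3) → Bool)) (aPat g) := by
  classical
  unfold pdist
  -- inject `Fin (D+1)`: `j ↦ 2j+1` if `2j+1 < g` (an odd position before `g`), else `2j+2`
  let φ : Fin (D + 1) → Fin (2 * D + 3) := fun j =>
    if 2 * j.val + 1 < g then ⟨2 * j.val + 1, by omega⟩ else ⟨2 * j.val + 2, by omega⟩
  have hφv : ∀ j : Fin (D + 1), (φ j).val = if 2 * j.val + 1 < g then 2 * j.val + 1 else 2 * j.val + 2 := by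
    intro j
    show (if 2 * j.val + 1 < g then (⟨2 * j.val + 1, _⟩ : Fin (2 * D + 3)) else ⟨2 * j.val + 2, _⟩).val = _
    split_ifs <;> rfl
  have hinj : Function.Injective φ := by
    intro j j' h
    have hv : (φ j).val = (φ j').val := by rw [h]
    rw [hφv, hφv] at hv
    apply Fin.ext
    split_ifs at hv <;> omega
  have hcard : (univ.image φ).card = D + 1 := by
    rw [Finset.card_image_of_injective _ hinj]; simp
  rw [← hcard]
  refine Finset.card_le_card fun i hi => ?_
  rw [Finset.mem_image] at hi
  obtain ⟨j, -, rfl⟩ := hi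
  rw [Finset.mem_filter, conj_alt_ne_aPat_iff, hφv]
  refine ⟨Finset.mem_univ _, ?_⟩
  split_ifs with h1 <;> omega

/-! ### The full module and the exact law -/

/-- The module `M_D(P) = Σ_g 𝔽₄[u]_{≤D}·χ_{a^{(g)}}` of FULL strategies of degree `D` on `m` bits
(all path characters `g ∈ ℕ`; for `g ≥ m` the pattern is `2^m`). -/
def fullSpan (m D : ℕ) : Submodule F4 ((Fin m → Bool) → F4) :=
  Submodule.span F4 {f | ∃ g : ℕ, ∃ T : Finset (Fin m), T.card ≤ D ∧ f = fun u => monoF T u * chi (aPat g) u}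

/-- Near the path: within Hamming distance `D` of some path pattern (a predicate on patterns).
[folklore] -/
def NearPath (D : ℕ) (a : Fin m → Bool) : Prop := ∃ g : ℕ, pdist a (aPat g) ≤ D

/-- The full module has spectrum near the path. -/
theorem fullSpan_le_chiSpan (m D : ℕ) : fullSpan m D ≤ chiSpan (NearPath (m := m) D) := by
  unfold fullSpan
  refine Submodule.span_le.2 ?_
  rintro f ⟨g, T, hT, rfl⟩
  exact chiSpan_mono (fun a ha => ⟨g, le_trans ha hT⟩) (mono_mul_chi_mem T (aPat g))

/-- **THE FULL EXACT LAW (lower half).**  On `2D+3` bits no element `f` of the full module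
`M_D(P)` has `tr f ≡ 1`: no full (a fortiori no walk / ring) strategy of degree `D` is perfect.
[folklore] -/
theorem fullSpan_not_perfect (D : ℕ) {f : (Fin (2 * D + 3) → Bool) → F4}
    (hf : f ∈ fullSpan (2 * D + 3) D) : ∃ u, tr (f u) ≠ 1 := by
  classical
  by_contra hall'
  have hall : ∀ u, tr (f u) = 1 := fun u => by
    by_contra h
    exact hall' ⟨u, h⟩
  -- `tr f = f + f²` has spectrum in `N_D(P) ∪ N_D(P̄)`
  have h1 : f ∈ chiSpan (NearPath (m := 2 * D + 3) D) := fullSpan_le_chiSpan _ _ hf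
  have h2 : (fun u => f u ^ 2) ∈ chiSpan fun a => NearPath (m := 2 * D + 3) D (conj a) :=
    sq_mem_chiSpan h1
  set Q : (Fin (2 * D + 3) → Bool) → Prop := fun a => NearPath D a ∨ NearPath D (conj a) with hQ
  have htr : (fun u => tr (f u)) ∈ chiSpan Q := by
    have e : (fun u => tr (f u)) = f + fun u => f u ^ 2 := by funext u; rfl
    rw [e]
    exact Submodule.add_mem _ (chiSpan_mono (fun a ha => Or.inl ha) h1)
      (chiSpan_mono (fun a ha => Or.inr ha) h2)
  -- but `tr f = 1`, and `L_alt` separates `1` from that span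
  have hone : (fun u => tr (f u)) = fun _ => (1 : F4) := funext hall
  have halt : ¬ Q alt := by
    rintro (⟨g, hg⟩ | ⟨g, hg⟩)
    · have := pdist_alt_aPat D g; omega
    · have := pdist_conj_alt_aPat D g; omega
  have hz := Lfun_eq_zero_of_mem halt htr
  rw [hone] at hz
  exact Lfun_one_ne_zero alt hz

end Summit.QuantumAdvantage.AdviceFreeQNC0

end
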